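import Mathlib.Analysis.Fourier.Inversion
import Mathlib.Analysis.Fourier.FourierTransform
import Mathlib.NumberTheory.LSeries.Basic
import Mathlib.Analysis.SpecialFunctions.ImproperIntegrals
import Mathlib.Analysis.SpecialFunctions.Integrals.Basic
import Mathlib.MeasureTheory.Integral.ExpDecay
import Mathlib.MeasureTheory.Integral.IntegralEqImproper
import Mathlib.MeasureTheory.Measure.Lebesgue.Integral
import Mathlib.Probability.Distributions.Cauchy
import HarnessLib

/-!
# Poisson-kernel smoothing of Dirichlet series (Granville–Soundararajan 2003, Lemma 2.2)

Let `L(s) = ∑ a_n n^{-s}` with `∑ |a_n| n^{-σ₀} < ∞`.  Since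
`n^{-α} = ∫_ℝ K_α(u) n^{-iu} du` with the Cauchy–Poisson kernel `K_α(u) = (α/π)/(α² + u²)`
(the Fourier pair `e^{-α|v|} ↔ 2α/(α² + 4π²ξ²)`, via Mathlib's Fourier inversion), one has
`L(σ₀ + α + iy) = ∫ K_α(u) L(σ₀ + i(y+u)) du`, whence the smoothing inequality
(Granville–Soundararajan 2003, Lemma 2.2): if `|L(σ₀ + iu)| ≤ B` for `|u| ≤ |y| + T₀` then
`|L(σ₀ + α + iy)| ≤ B + (2α/T₀) ∑ |a_n| n^{-σ₀}`.
In Halász's theorem this transports the bound for the Euler product on the line `Re s = 1`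
to the lines `Re s = 1 + α` (Granville–Soundararajan 2003, (4.2)).  The kernel is Mathlib's
Cauchy density (`ProbabilityTheory.cauchyPDFReal`, see `kernel_eq_cauchyPDFReal`); Lemma 2.2 is
not among the Granville–Soundararajan results vendored as named facts in
`Literature.NumberTheory.LFunctions.GranvilleSoundararajan2003` (Thm 1, Lemma 2.3, Thm 3, Cor 3,
Lemma 7.1, Thm 4), and here it is proved.

## Main results
- `Literature.NumberTheory.LFunctions.PoissonSmoothing.kernel`, `kernel_eq_cauchyPDFReal`, `integral_kernel` : the kernel, its
  identification with `cauchyPDFReal 0 α`, and `∫ K_α = 1`.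
- `Literature.NumberTheory.LFunctions.PoissonSmoothing.natCast_cpow_neg_eq_integral` : `n^{-α} = ∫ K_α(u) n^{-iu} du`.
- `Literature.NumberTheory.LFunctions.PoissonSmoothing.norm_LSeries_le_of_bound` : the smoothing inequality (Lemma 2.2).

## References
- [GranvilleSoundararajan2003] A. Granville, K. Soundararajan, *Decay of mean values of
  multiplicative functions*, Canad. J. Math. 55 (2003), Lemma 2.2 and (4.2).
-/

noncomputable section

open MeasureTheory Real Complex Set Filter FourierTransform
open scoped NNReal

namespace Literature.NumberTheory.LFunctions

namespace PoissonSmoothing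

/-! ### The Cauchy–Poisson kernel `K_α(u) = (α/π)/(α² + u²)` -/

/-- The Poisson (Cauchy) kernel on the line, `K_α(u) = (α/π)/(α² + u²)`.  For `α > 0` this is
Mathlib's Cauchy density `ProbabilityTheory.cauchyPDFReal 0 ⟨α, _⟩` (`kernel_eq_cauchyPDFReal`),
from which positivity, integrability and mass `1` are imported; we keep a plain `ℝ`-parametrised
name because the scale enters the estimates below as a real variable. [folklore] -/
def kernel (α u : ℝ) : ℝ := α / π / (α ^ 2 + u ^ 2)

/-- An algebraic identity: `1/(α - iβ) - 1/(-α - iβ) = 2α/(α² + β²)`. [folklore] -/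
theorem one_div_add_aux {α : ℝ} (hα : 0 < α) (β : ℝ) :
    1 / ((α : ℂ) - β * I) + -1 / (-(α : ℂ) - β * I) = ((2 * α / (α ^ 2 + β ^ 2) : ℝ) : ℂ) := by
  have h1 : (α : ℂ) - β * I ≠ 0 := by
    intro h; have := congrArg Complex.re h; simp at this; linarith
  have h2 : -(α : ℂ) - β * I ≠ 0 := by
    intro h; have := congrArg Complex.re h; simp at this; linarith
  have h3 : (α : ℂ) + β * I ≠ 0 := by
    intro h; have := congrArg Complex.re h; simp at this; linarith
  have hd : ((α ^ 2 + β ^ 2 : ℝ) : ℂ) ≠ 0 := by norm_cast; positivity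
  have e1 : -1 / (-(α : ℂ) - β * I) = 1 / ((α : ℂ) + β * I) := by
    rw [show -(α : ℂ) - β * I = -((α : ℂ) + β * I) by ring, div_neg, neg_div, neg_neg]
  rw [e1, div_add_div _ _ h1 h3, div_eq_iff (mul_ne_zero h1 h3)]
  push_cast
  have hd' : (α : ℂ) ^ 2 + (β : ℂ) ^ 2 ≠ 0 := by exact_mod_cast hd
  rw [div_mul_eq_mul_div, eq_div_iff hd']
  ring_nf
  rw [Complex.I_sq]
  ring

variable {α : ℝ} (hα : 0 < α)
include hα

/-- `K_α` is the Cauchy density of Mathlib with location `0` and scale `α`. [folklore] -/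
theorem kernel_eq_cauchyPDFReal (u : ℝ) :
    kernel α u = ProbabilityTheory.cauchyPDFReal 0 ⟨α, hα.le⟩ u := by
  rw [ProbabilityTheory.cauchyPDFReal_def]
  change _ = π⁻¹ * α * ((u - 0) ^ 2 + α ^ 2)⁻¹
  unfold kernel
  rw [sub_zero, add_comm (u ^ 2)]
  field_simp

/-- `K_α = cauchyPDFReal 0 α` as functions. [folklore] -/
theorem kernel_eq_cauchyPDFReal' : kernel α = ProbabilityTheory.cauchyPDFReal 0 ⟨α, hα.le⟩ :=
  funext (kernel_eq_cauchyPDFReal hα)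

/-- The scale `⟨α, _⟩ : ℝ≥0` is nonzero. [folklore] -/
theorem scale_ne_zero : (⟨α, hα.le⟩ : ℝ≥0) ≠ 0 :=
  (NNReal.coe_pos.mp (by exact hα : (0 : ℝ) < ((⟨α, hα.le⟩ : ℝ≥0) : ℝ))).ne'

/-- `K_α(u) > 0` (`α > 0`), from `ProbabilityTheory.cauchyPDF_pos`. [folklore] -/
theorem kernel_pos (u : ℝ) : 0 < kernel α u := by
  rw [kernel_eq_cauchyPDFReal hα]
  exact ProbabilityTheory.cauchyPDF_pos 0 (scale_ne_zero hα) u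

/-- `K_α ∈ L¹(ℝ)`, from `ProbabilityTheory.integrable_cauchyPDFReal`. [folklore] -/
theorem integrable_kernel : Integrable (kernel α) := by
  rw [kernel_eq_cauchyPDFReal' hα]
  exact ProbabilityTheory.integrable_cauchyPDFReal 0

/-- `∫ K_α = 1`, from `ProbabilityTheory.integral_cauchyPDFReal_eq_one`. [folklore] -/
theorem integral_kernel : ∫ u, kernel α u = 1 := by
  rw [kernel_eq_cauchyPDFReal' hα]
  exact ProbabilityTheory.integral_cauchyPDFReal_eq_one 0 (scale_ne_zero hα)

/-- `K_α(u) ≤ (α/π) u⁻²` for `u ≠ 0`. [folklore] -/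
theorem kernel_le_inv_sq (u : ℝ) (hu : u ≠ 0) : kernel α u ≤ α / π * (u ^ 2)⁻¹ := by
  unfold kernel
  rw [← div_eq_mul_inv]
  exact div_le_div_of_nonneg_left (by positivity) (by positivity) (by nlinarith [sq_nonneg α])

/-! ### The Fourier pair `e^{-α|v|} ↔ 2α/(α² + 4π²ξ²)` -/

/-- `f(v) = e^{-α|v|}` as a complex-valued function. [folklore] -/
def expAbs (α : ℝ) (v : ℝ) : ℂ := (Real.exp (-(α * |v|)) : ℂ)

omit hα in
/-- `v ↦ e^{-α|v|}` is continuous. [folklore] -/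
theorem continuous_expAbs : Continuous (expAbs α) := by
  unfold expAbs; fun_prop

/-- `v ↦ e^{-α|v|}` is integrable. [folklore] -/
theorem integrable_expAbs : Integrable (expAbs α) := by
  have h1 : IntegrableOn (expAbs α) (Set.Ioi 0) := by
    have h0 : IntegrableOn (fun v : ℝ => ((Real.exp (-α * v) : ℝ) : ℂ)) (Set.Ioi 0) :=
      (exp_neg_integrableOn_Ioi 0 hα).ofReal
    refine IntegrableOn.congr_fun h0 (fun v hv => ?_) measurableSet_Ioi
    show ((Real.exp (-α * v) : ℝ) : ℂ) = expAbs α v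
    simp only [expAbs, abs_of_pos (show (0:ℝ) < v from hv), neg_mul]
  have h2 : IntegrableOn (expAbs α) (Set.Iic 0) := by
    rw [← Measure.map_neg_eq_self (volume : Measure ℝ)]
    let m : MeasurableEmbedding fun x : ℝ => -x := (Homeomorph.neg ℝ).measurableEmbedding
    rw [m.integrableOn_map_iff]
    have hcomp : (expAbs α) ∘ (fun x : ℝ => -x) = expAbs α := by
      funext x; simp [expAbs, abs_neg]
    have hpre : (fun x : ℝ => -x) ⁻¹' (Set.Iic 0) = Set.Ici 0 := by
      ext x; simp
    rw [hcomp, hpre]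
    exact Iff.mpr integrableOn_Ici_iff_integrableOn_Ioi h1
  have := h2.union h1
  rwa [Set.Iic_union_Ioi, integrableOn_univ] at this

/-- `𝓕 f (ξ) = 2α/(α² + 4π²ξ²)`. [folklore] -/
theorem fourier_expAbs (ξ : ℝ) :
    𝓕 (expAbs α) ξ = ((2 * α / (α ^ 2 + 4 * π ^ 2 * ξ ^ 2) : ℝ) : ℂ) := by
  rw [Real.fourier_real_eq_integral_exp_smul]
  set β : ℝ := 2 * π * ξ with hβ
  -- split at `0`
  have hint : Integrable fun v : ℝ => Complex.exp (↑(-2 * π * v * ξ) * I) • expAbs α v := by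
    have hb : MemLp (fun v : ℝ => Complex.exp (↑(-2 * π * v * ξ) * I)) ⊤ volume := by
      refine memLp_top_of_bound ?_ 1 (Filter.Eventually.of_forall fun v => ?_)
      · exact (by fun_prop : Continuous fun v : ℝ => Complex.exp (↑(-2 * π * v * ξ) * I)).aestronglyMeasurable
      · rw [Complex.norm_exp_ofReal_mul_I]
    refine ((integrable_expAbs hα).smul_of_top_left hb).congr (Filter.Eventually.of_forall fun v => ?_)
    simp only [Pi.smul_apply', smul_eq_mul]; ring
  have hsplit : ∫ v : ℝ, Complex.exp (↑(-2 * π * v * ξ) * I) • expAbs α v =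
      (∫ v in Set.Iic (0:ℝ), Complex.exp (((α : ℂ) - β * I) * v)) +
        ∫ v in Set.Ioi (0:ℝ), Complex.exp ((-(α : ℂ) - β * I) * v) := by
    rw [← setIntegral_univ, ← Set.Iic_union_Ioi (a := (0:ℝ)),
      setIntegral_union (Set.Iic_disjoint_Ioi le_rfl) measurableSet_Ioi hint.integrableOn hint.integrableOn]
    congr 1
    · refine setIntegral_congr_fun measurableSet_Iic fun v hv => ?_
      simp only [expAbs, smul_eq_mul, abs_of_nonpos (show v ≤ 0 from hv), hβ]
      rw [Complex.ofReal_exp, ← Complex.exp_add]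
      congr 1; push_cast; ring
    · refine setIntegral_congr_fun measurableSet_Ioi fun v hv => ?_
      simp only [expAbs, smul_eq_mul, abs_of_pos (show 0 < v from hv), hβ]
      rw [Complex.ofReal_exp, ← Complex.exp_add]
      congr 1; push_cast; ring
  rw [hsplit, integral_exp_mul_complex_Iic (by simp [hα]) 0, integral_exp_mul_complex_Ioi (by simp [hα]) 0]
  have e0 : (((0 : ℝ) : ℂ)) = 0 := Complex.ofReal_zero
  rw [e0, mul_zero, mul_zero, Complex.exp_zero, neg_div, ← neg_one_mul ((1:ℂ) / _), neg_one_mul,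
    ← neg_div, one_div_add_aux hα β, hβ]
  congr 1
  ring

/-- The Fourier transform `2α/(α² + 4π²ξ²)` of `e^{-α|v|}` is integrable. [folklore] -/
theorem integrable_fourier_expAbs : Integrable (𝓕 (expAbs α)) := by
  have h : Integrable fun ξ : ℝ => ((2 / α * (1 + (2 * π / α * ξ) ^ 2)⁻¹ : ℝ) : ℂ) :=
    ((integrable_inv_one_add_sq.comp_mul_left' (by positivity : 2 * π / α ≠ 0)).const_mul (2 / α)).ofReal
  refine h.congr (Filter.Eventually.of_forall fun ξ => ?_)
  rw [fourier_expAbs hα]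
  exact congrArg Complex.ofReal (by field_simp; ring)

/-- Fourier inversion for the pair: `∫ e^{-2πiξv} 𝓕f(ξ) dξ = e^{-α|v|}` (`f` is even). [folklore] -/
theorem fourier_fourier_expAbs (v : ℝ) : 𝓕 (𝓕 (expAbs α)) v = expAbs α v := by
  have h := (continuous_expAbs (α := α)).fourierInv_fourier_eq (integrable_expAbs hα)
    (integrable_fourier_expAbs hα)
  have h' := congrFun h (-v)
  rw [Real.fourierInv_eq_fourier_neg, neg_neg] at h'
  rw [h']
  simp [expAbs]

/-- **The Poisson kernel identity**: for real `v`, `∫ K_α(u) e^{-iuv} du = e^{-α|v|}`. [folklore] -/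
theorem integral_kernel_mul_exp (v : ℝ) :
    ∫ u : ℝ, (kernel α u : ℂ) * Complex.exp (-(u * v : ℝ) * I) = (Real.exp (-(α * |v|)) : ℂ) := by
  have h := fourier_fourier_expAbs hα v
  rw [Real.fourier_real_eq_integral_exp_smul] at h
  simp_rw [fourier_expAbs hα] at h
  -- `h : ∫ ξ, exp(-2πiξv) • (2α/(α²+4π²ξ²)) = e^{-α|v|}`; substitute `u = 2π ξ`
  set H : ℝ → ℂ := fun u => (kernel α u : ℂ) * Complex.exp (-(u * v : ℝ) * I) with hH
  have hsub : (fun ξ : ℝ => Complex.exp (↑(-2 * π * ξ * v) * I) • ((2 * α / (α ^ 2 + 4 * π ^ 2 * ξ ^ 2) : ℝ) : ℂ))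
      = fun ξ : ℝ => ((2 * π : ℝ) : ℂ) * H ((2 * π) * ξ) := by
    funext ξ
    simp only [hH, kernel, smul_eq_mul]
    have e1 : Complex.exp (↑(-2 * π * ξ * v) * I) = Complex.exp (-(((2 * π * ξ) * v : ℝ) : ℂ) * I) := by
      congr 1; push_cast; ring
    have e2 : ((2 * α / (α ^ 2 + 4 * π ^ 2 * ξ ^ 2) : ℝ) : ℂ) =
        ((2 * π : ℝ) : ℂ) * ((α / π / (α ^ 2 + (2 * π * ξ) ^ 2) : ℝ) : ℂ) := by
      rw [← Complex.ofReal_mul]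
      congr 1
      field_simp
      ring
    rw [e1, e2]
    ring
  rw [hsub, integral_const_mul, Measure.integral_comp_mul_left H, abs_of_pos (by positivity)] at h
  have hπ : ((2 * π : ℝ) : ℂ) * (((2 * π)⁻¹ : ℝ) : ℂ) = 1 := by
    rw [← Complex.ofReal_mul, mul_inv_cancel₀ (by positivity), Complex.ofReal_one]
  have : ∫ y, H y = expAbs α v := by
    rw [← h, Complex.real_smul, ← mul_assoc, hπ, one_mul]
  rw [this]
  simp [expAbs]

/-- For `n ≥ 1`: `n^{-α} = ∫ K_α(u) n^{-iu} du`. [folklore] -/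
theorem natCast_cpow_neg_eq_integral {n : ℕ} (hn : 1 ≤ n) :
    ((n : ℂ)) ^ (-(α : ℂ)) = ∫ u : ℝ, (kernel α u : ℂ) * (n : ℂ) ^ (-((u : ℂ) * I)) := by
  have hn0 : (n : ℂ) ≠ 0 := by exact_mod_cast (show n ≠ 0 by omega)
  have hlog : 0 ≤ Real.log n := Real.log_nonneg (by exact_mod_cast hn)
  have h := integral_kernel_mul_exp hα (Real.log n)
  rw [abs_of_nonneg hlog] at h
  have hL : ((n : ℂ)) ^ (-(α : ℂ)) = (Real.exp (-(α * Real.log n)) : ℂ) := by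
    rw [Complex.cpow_def_of_ne_zero hn0, ← Complex.ofReal_natCast, ← Complex.ofReal_log (Nat.cast_nonneg n),
      Complex.ofReal_exp]
    congr 1; push_cast; ring
  rw [hL, ← h]
  refine integral_congr_ae (Filter.Eventually.of_forall fun u => ?_)
  simp only
  congr 1
  rw [Complex.cpow_def_of_ne_zero hn0, ← Complex.ofReal_natCast, ← Complex.ofReal_log (Nat.cast_nonneg n)]
  congr 1; push_cast; ring


/-! ### Smoothing a Dirichlet series -/

omit hα in
/-- `‖L(s)‖ ≤ ∑ ‖a_n‖ n^{-σ₀}` on the line `Re s = σ₀`. [folklore] -/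
theorem norm_LSeries_le_tsum {a : ℕ → ℂ} {σ₀ : ℝ}
    (hsum : Summable fun n : ℕ => ‖a n‖ / (n : ℝ) ^ σ₀) (t : ℝ) :
    ‖LSeries a (σ₀ + t * I)‖ ≤ ∑' n : ℕ, ‖a n‖ / (n : ℝ) ^ σ₀ := by
  unfold LSeries
  refine (norm_tsum_le_tsum_norm ?_).trans ?_
  · refine Summable.of_nonneg_of_le (fun n => norm_nonneg _) (fun n => ?_) hsum
    rcases Nat.eq_zero_or_pos n with rfl | hn
    · simp only [LSeries.term_zero, norm_zero]; positivity
    · rw [LSeries.term_of_ne_zero hn.ne', norm_div, Complex.norm_natCast_cpow_of_pos hn]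
      simp
  · refine Summable.tsum_le_tsum (fun n => ?_) ?_ hsum
    · rcases Nat.eq_zero_or_pos n with rfl | hn
      · simp only [LSeries.term_zero, norm_zero]; positivity
      · rw [LSeries.term_of_ne_zero hn.ne', norm_div, Complex.norm_natCast_cpow_of_pos hn]
        simp
    · refine Summable.of_nonneg_of_le (fun n => norm_nonneg _) (fun n => ?_) hsum
      rcases Nat.eq_zero_or_pos n with rfl | hn
      · simp only [LSeries.term_zero, norm_zero]; positivity
      · rw [LSeries.term_of_ne_zero hn.ne', norm_div, Complex.norm_natCast_cpow_of_pos hn]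
        simp

omit hα in
/-- `|a_n n^{-(σ₀+it)}| = |a_n| n^{-σ₀}` for `n ≥ 1` (the case `n ≠ 0` of Mathlib's
`LSeries.norm_term_eq`, on the line `Re s = σ₀`). [folklore] -/
theorem norm_term_line_eq {a : ℕ → ℂ} {σ₀ : ℝ} (t : ℝ) {n : ℕ} (hn : 0 < n) :
    ‖LSeries.term a (σ₀ + t * I) n‖ = ‖a n‖ / (n : ℝ) ^ σ₀ := by
  rw [LSeries.norm_term_eq, if_neg hn.ne']
  simp

omit hα in
/-- `u ↦ a_n n^{-(σ₀ + i(y+u))}` is continuous. [folklore] -/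
theorem continuous_term {a : ℕ → ℂ} {σ₀ : ℝ} (y : ℝ) (n : ℕ) :
    Continuous fun u : ℝ => LSeries.term a (σ₀ + (y + u : ℝ) * I) n := by
  rcases Nat.eq_zero_or_pos n with rfl | hn
  · simp only [LSeries.term_zero]; exact continuous_const
  · have hn0 : (n : ℂ) ≠ 0 := by exact_mod_cast hn.ne'
    have : (fun u : ℝ => LSeries.term a (σ₀ + (y + u : ℝ) * I) n) =
        fun u : ℝ => a n / Complex.exp (Complex.log n * (σ₀ + (y + u : ℝ) * I)) := by
      funext u; rw [LSeries.term_of_ne_zero hn.ne', Complex.cpow_def_of_ne_zero hn0]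
    rw [this]
    exact continuous_const.div (by fun_prop) (fun u => Complex.exp_ne_zero _)

/-- The key representation: for `n ≥ 1`,
`a_n n^{-(σ₀+α+iy)} = ∫ K_α(u) a_n n^{-(σ₀ + i(y+u))} du`. [folklore] -/
theorem term_eq_integral {a : ℕ → ℂ} {σ₀ : ℝ} (y : ℝ) {n : ℕ} (hn : 1 ≤ n) :
    LSeries.term a (σ₀ + α + y * I) n =
      ∫ u : ℝ, (kernel α u : ℂ) * LSeries.term a (σ₀ + (y + u : ℝ) * I) n := by
  have hn0 : (n : ℂ) ≠ 0 := by exact_mod_cast (show n ≠ 0 by omega)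
  rw [LSeries.term_of_ne_zero (by omega)]
  have hsplit : (n : ℂ) ^ ((σ₀ : ℂ) + α + y * I) = (n : ℂ) ^ ((σ₀ : ℂ) + y * I) * (n : ℂ) ^ (α : ℂ) := by
    rw [← Complex.cpow_add _ _ hn0]; congr 1; ring
  rw [hsplit, div_mul_eq_div_mul_one_div, one_div, ← Complex.cpow_neg, natCast_cpow_neg_eq_integral hα hn,
    ← integral_const_mul]
  refine integral_congr_ae (Filter.Eventually.of_forall fun u => ?_)
  simp only
  rw [LSeries.term_of_ne_zero (by omega)]
  have : (n : ℂ) ^ ((σ₀ : ℂ) + ((y + u : ℝ) : ℂ) * I) = (n : ℂ) ^ ((σ₀ : ℂ) + y * I) * (n : ℂ) ^ ((u : ℂ) * I) := by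
    rw [← Complex.cpow_add _ _ hn0]; congr 1; push_cast; ring
  rw [this, Complex.cpow_neg]
  field_simp


/-- **Granville–Soundararajan 2003, Lemma 2.2, (2.5)** (explicit-constant form): if
`∑ |a_n| n^{-σ₀} = S < ∞`, `α > 0`, `T₀ > 0` and `|L(σ₀ + iu)| ≤ B` for all `|u| ≤ |y| + T₀`, then
`|L(σ₀ + α + iy)| ≤ B + 2αS/T₀` (GS: `max_{|y| ≤ T} |A(1+α+iy)| ≤ max_{|y| ≤ 2T} |A(1+iy)| + O(α S/T)`).
Proof: `n^{-α} = ∫ K_α(u) n^{-iu} du` with the Poisson kernel `K_α ≥ 0` of mass `1`, so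
`L(σ₀+α+iy) = ∫ K_α(u) L(σ₀ + i(y+u)) du`; on `|u| > T₀` use `K_α(u) ≤ (2α/T₀) K_{T₀}(u)`.
[cite: GranvilleSoundararajan2003, Lemma 2.2] -/
theorem norm_LSeries_le_of_bound {a : ℕ → ℂ} {σ₀ : ℝ}
    (hsum : Summable fun n : ℕ => ‖a n‖ / (n : ℝ) ^ σ₀) {T₀ : ℝ} (hT : 0 < T₀) (y : ℝ) {B : ℝ}
    (hB : ∀ u : ℝ, |u| ≤ |y| + T₀ → ‖LSeries a (σ₀ + u * I)‖ ≤ B) :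
    ‖LSeries a (σ₀ + α + y * I)‖ ≤ B + 2 * α / T₀ * ∑' n : ℕ, ‖a n‖ / (n : ℝ) ^ σ₀ := by
  set S : ℝ := ∑' n : ℕ, ‖a n‖ / (n : ℝ) ^ σ₀ with hS
  have hS0 : 0 ≤ S := tsum_nonneg fun n => by positivity
  have hB0 : 0 ≤ B := (norm_nonneg _).trans (hB y (by linarith [abs_nonneg y]))
  -- the summands as integrals
  set F : ℕ → ℝ → ℂ := fun n u => (kernel α u : ℂ) * LSeries.term a (σ₀ + (y + u : ℝ) * I) n with hF
  have hFint : ∀ n, Integrable (F n) := by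
    intro n
    have hcont : Continuous (F n) := by
      simp only [hF]
      exact (Complex.continuous_ofReal.comp (by
        unfold kernel; exact continuous_const.div (by fun_prop) (fun u => by positivity))).mul
        (continuous_term y n)
    refine Integrable.mono' ((integrable_kernel hα).mul_const (‖a n‖ / (n : ℝ) ^ σ₀))
      hcont.aestronglyMeasurable (Filter.Eventually.of_forall fun u => ?_)
    simp only [hF, norm_mul, Complex.norm_real, Real.norm_of_nonneg (kernel_pos hα u).le]
    refine mul_le_mul_of_nonneg_left ?_ (kernel_pos hα u).le
    rcases Nat.eq_zero_or_pos n with h0 | hn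
    · subst h0; simp only [LSeries.term_zero, norm_zero]; positivity
    · exact le_of_eq (norm_term_line_eq _ hn)
  have hFnorm : ∀ n, ∫ u, ‖F n u‖ = ‖a n‖ / (n : ℝ) ^ σ₀ * (if n = 0 then 0 else 1) := by
    intro n
    rcases Nat.eq_zero_or_pos n with rfl | hn
    · simp [hF]
    · simp only [hF, norm_mul, Complex.norm_real, Real.norm_of_nonneg (kernel_pos hα _).le,
        norm_term_line_eq _ hn, hn.ne', if_false]
      rw [integral_mul_const, integral_kernel hα]; ring
  have hrepr : LSeries a (σ₀ + α + y * I) = ∫ u, (kernel α u : ℂ) * LSeries a (σ₀ + (y + u : ℝ) * I) := by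
    have h1 : LSeries a (σ₀ + α + y * I) = ∑' n, ∫ u, F n u := by
      unfold LSeries
      refine tsum_congr fun n => ?_
      rcases Nat.eq_zero_or_pos n with rfl | hn
      · simp [hF]
      · exact term_eq_integral hα y hn
    rw [h1, integral_tsum_of_summable_integral_norm hFint]
    · refine integral_congr_ae (Filter.Eventually.of_forall fun u => ?_)
      simp only [hF]
      rw [tsum_mul_left]
      rfl
    · simp_rw [hFnorm]
      refine Summable.of_nonneg_of_le (fun n => by positivity) (fun n => ?_) hsum
      split_ifs with h
      · simp only [mul_zero]; positivity
      · simp only [mul_one]; exact le_rfl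
  -- the majorant
  set g : ℝ → ℝ := fun u => B * kernel α u + (2 * α / T₀ * S) * kernel T₀ u with hg
  have hgint : Integrable g :=
    ((integrable_kernel hα).const_mul B).add ((integrable_kernel hT).const_mul _)
  have hgval : ∫ u, g u = B + 2 * α / T₀ * S := by
    simp only [hg]
    rw [integral_add ((integrable_kernel hα).const_mul B) ((integrable_kernel hT).const_mul _),
      integral_const_mul, integral_const_mul, integral_kernel hα, integral_kernel hT]
    ring
  have hpt : ∀ u, ‖(kernel α u : ℂ) * LSeries a (σ₀ + (y + u : ℝ) * I)‖ ≤ g u := by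
    intro u
    rw [norm_mul, Complex.norm_real, Real.norm_of_nonneg (kernel_pos hα u).le]
    simp only [hg]
    rcases le_or_gt |u| T₀ with hu | hu
    · have : ‖LSeries a (σ₀ + (y + u : ℝ) * I)‖ ≤ B :=
        hB (y + u) ((abs_add_le y u).trans (by linarith))
      have hk : 0 ≤ (2 * α / T₀ * S) * kernel T₀ u := by
        have := kernel_pos hT u; positivity
      calc kernel α u * ‖LSeries a (σ₀ + (y + u : ℝ) * I)‖ ≤ kernel α u * B :=
            mul_le_mul_of_nonneg_left this (kernel_pos hα u).le
        _ ≤ _ := by linarith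
    · have hu0 : u ≠ 0 := by intro h; rw [h, abs_zero] at hu; linarith
      have hL : ‖LSeries a (σ₀ + (y + u : ℝ) * I)‖ ≤ S := norm_LSeries_le_tsum hsum _
      have hk1 := kernel_le_inv_sq hα u hu0
      -- `(u²)⁻¹ ≤ (2π/T₀) K_{T₀}(u)` for `|u| > T₀`
      have hu2 : T₀ ^ 2 < u ^ 2 := by
        calc T₀ ^ 2 < |u| ^ 2 := by gcongr
          _ = u ^ 2 := sq_abs u
      have hk2 : (u ^ 2)⁻¹ ≤ 2 * π / T₀ * kernel T₀ u := by
        unfold kernel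
        rw [show 2 * π / T₀ * (T₀ / π / (T₀ ^ 2 + u ^ 2)) = 2 / (T₀ ^ 2 + u ^ 2) by field_simp]
        rw [inv_eq_one_div, div_le_div_iff₀ (by positivity) (by positivity)]
        nlinarith
      have hBk : 0 ≤ B * kernel α u := mul_nonneg hB0 (kernel_pos hα u).le
      calc kernel α u * ‖LSeries a (σ₀ + (y + u : ℝ) * I)‖ ≤ (α / π * (u ^ 2)⁻¹) * S := by
            gcongr
        _ ≤ (α / π * (2 * π / T₀ * kernel T₀ u)) * S := by gcongr
        _ = (2 * α / T₀ * S) * kernel T₀ u := by field_simp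
        _ ≤ _ := by linarith
  rw [hrepr]
  calc ‖∫ u, (kernel α u : ℂ) * LSeries a (σ₀ + (y + u : ℝ) * I)‖ ≤ ∫ u, g u :=
        norm_integral_le_of_norm_le hgint (Filter.Eventually.of_forall hpt)
    _ = B + 2 * α / T₀ * S := hgval

end PoissonSmoothing

end Literature.NumberTheory.LFunctions
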